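import Literature.NumberTheory.GelbartRogawski1991.LocalDoubledUnitaryIwahori      -- ★ `isSiegelDelta_iff_blkC_eq_zero`, `matA`, `gramS`, `localFormD_eq`
import Literature.NumberTheory.GelbartRogawski1991.LocalUnitaryUndoubling          -- ★ `inlLoc : U(T₀)(F_v) →* U(T₀ ⊕ −T₀)(F_v)`
import Literature.NumberTheory.Automorphic.UnitaryGroupHyperbolicSwap             -- ★ `lineSwapGL`, `localSwapElt`
import Summits.HodgeConjecture.HodgeConjecture.Theorems.F0P2oDoubledGraphLagrangian -- ★ p833917 §3/§6: the swap on `Δ`, the `Δ`-block, `det = α`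
import HarnessLib

/-!
# (C3′) The hyperbolic swap `w₀` of the doubled space and the Siegel memberships `w₀ (g ⊕ 1) w₀ ∈ P_Δ`

Crux H413 (`stmt-HodgeConjecture-24833`), N3 night road (b) (lead B-p18 (g28), desk F0P2-plan (g8)); the GROUP-LEVEL input
`(hw₀) (hs1) (hs2)` of A-p16 (g24)'s CM-datum assembler `LocalSplittingCMParabolicEigenfunctional` ∕
`Theorems/F0P2oThetaJacquetTorusWeight.lean`.  KERNEL MATHEMATICS ONLY (theorems; no `def`, no instance, no notation, no
named fact, no `sorry`).

Setting: `E/F` CM-type quadratic (`c`, `δ`), a finite place `v`, `S := E ⊗ F_v = Π_{w ∣ v} E_w` (`LocalRing E v`),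
`σ := c ⊗ 1` (`conjLocal`), `G := T₀ ⊗ 1 ∈ M_n(S)` (`gramS`), the doubled hermitian space `𝔻 = 𝕍 ⊕ (−𝕍)` with Gram matrix
`J^𝔻 = (T₀ ⊕ −T₀) ⊗ 1` (`gramD`), its unitary group `H(F_v) = U(J^𝔻)(F_v)` (`localPi E c (n + n) JD v`), the embedding
`g ↦ g ⊕ 1` (`inlLoc`), the Siegel parabolic `P_Δ` of the diagonal `Δ` (`IsSiegelDelta`) and Kudla's `x(p) = det_Δ p`
(`detDelta`).  A HYPERBOLIC FRAME of `𝕍 ⊗ F_v` is `(y, y*)` with `h(y,y) = 0`, `h(y*,y) = h(y,y*) = 1` (`y*` need not be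
isotropic).

* §1 `matA (g ⊕ 1) = fromBlocks g 0 0 1` (adapted `Fin n ⊕ Fin n` blocks).
* §2 GENERIC IN THE SWAP: for any `w₀ ∈ H(F_v)` whose adapted matrix is the hyperbolic swap of ★ p833917 along
  `e − f`, `e = (y*, y*)`, `f = (y, 0)` (★ `lineSwapGL`), and any `g ∈ U(T₀ ⊗ 1)(F_v)` acting on the line `ℓ = S y` by a
  scalar `α` and trivially on `ℓ^⊥/ℓ` (`g y = α y`, `g b ∈ b + S y` for `b ⊥ y` — the elements of `P(ℓ) = M N` with trivial
  `U(ℓ^⊥/ℓ)`-part: `N(ℓ)` with `α = 1`, the torus `m(α)`):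
  **`w₀ (g ⊕ 1) w₀ ∈ P_Δ`** (`isSiegelDelta_of_matA_eq_lineSwap`) and **`det_Δ (w₀ (g ⊕ 1) w₀) = α`** at every `w ∣ v`
  (`detDelta_of_matA_eq_lineSwap`) — the `Δ`-block is `1 + y* ⊗ φ` with `φ(y*) = α − 1` (★ `swap_conj_blockOne_mulVec_diag`,
  ★ `det_deltaBlock_eq`).
* §3 THE SWAP ELEMENT: `J^𝔻` is hermitian (`conjTranspose_hermD`), `h_𝔻(e − f, e − f) = −2` in the tree's `Fin (n + n)`
  coordinates (`hermForm_localFormD_swapVector`), so ★ `localSwapElt` gives `w₀ ∈ H(F_v)` with `w₀⁻¹ = w₀`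
  (★ `localSwapElt_inv`), `w₀ w₀ = 1` (`localSwapElt_mul_self`) and adapted matrix the swap (`matA_localSwapElt`).
* §4 THE SOCKETS of the assembler: `isSiegelDelta_swap_inlLoc_swap`, `detDelta_swap_inlLoc_swap`, the `N(ℓ)` case
  (`α = 1`, `det_Δ = 1`) and the ∃-package `exists_involution_forall_isSiegelDelta`
  (`∃ w₀, w₀ * w₀ = 1 ∧ ∀ g α, … → IsSiegelDelta (w₀ * inlLoc g * w₀) ∧ ∀ w, detDelta w (w₀ * inlLoc g * w₀) = α w`).

References: [Kudla1994] S. Kudla, Israel J. Math. 87 (1994), §2–§3, Thm. 3.1; [HarrisKudlaSweet1996] §1 (1.11)–(1.16);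
[Dieudonne1971GroupesClassiques] Chap. II §5 (hyperbolic pairs, quasi-reflections); [GelbartRogawski1991] §3.1 Prop. 3.1.1.
HC_CM is NOT proved here; nothing here is a claim of the manuscripts adjudicated by the cell.
-/

set_option autoImplicit false
set_option linter.dupNamespace false

noncomputable section

open NumberField IsDedekindDomain Matrix
open Literature.NumberTheory.Automorphic Literature.NumberTheory.Automorphic.UnitaryGroup
open Literature.NumberTheory.GelbartRogawski1991.AdaptedBlocks
open Literature.NumberTheory.GelbartRogawski1991.UnitaryDualPair.LocalSplitting
open Summit.HodgeConjecture.HodgeConjecture.Cruxes.H413.F0P2oDoubledGraphLagrangian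

namespace Summit.HodgeConjecture.HodgeConjecture.Cruxes.H413.F0P2oDoubledSwapSiegel

variable (F : Type) [Field F] [NumberField F] (E : Type) [Field E] [NumberField E] [Algebra F E] (c : E ≃ₐ[F] E)
  (v : HeightOneSpectrum (𝓞 F)) (n : ℕ) {T₀ : Matrix (Fin n) (Fin n) F}
  {J : Matrix (Fin n) (Fin n) E} (hJ : J = T₀.map (algebraMap F E))
  {JD : Matrix (Fin (n + n)) (Fin (n + n)) E} (hJD : JD = (gramD F n T₀).map (algebraMap F E))

/-! ## §1 The adapted matrix of `g ⊕ 1` -/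

/-- **`matA (g ⊕ 1) = fromBlocks g 0 0 1`**: in the adapted `Fin n ⊕ Fin n` blocks of ★ `matA`, the embedded element
`inlLoc g = g ⊕ 1` has matrix `diag(g, 1)` (`g` = the matrix of `g ∈ U(T₀ ⊗ 1)(F_v)` over `E ⊗ F_v`).
[cite: GelbartRogawski1991, §3.1 Prop. 3.1.1 p. 455 L1–3] -/
theorem matA_inlLoc (g : UnitaryGroup.localPi E c n J v) :
    matA F E c v n (inlLoc F E c v n hJ hJD g) =
      Matrix.fromBlocks (((UnitaryGroup.localPiEquiv E c n J v g).1 : GL (Fin n) (LocalRing E v)).1) 0 0 1 := by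
  rw [matA, matS, localPiEquiv_inlLoc, coe_inlLocal]
  simp only [UnitaryGroup.coe_reindexGL, UnitaryGroup.coe_blockDiagGL, Units.val_one]
  rw [Matrix.reindex_apply, Matrix.reindex_apply, Matrix.submatrix_submatrix, Equiv.symm_symm, Equiv.symm_comp_self,
    Matrix.submatrix_id_id]

/-! ## §2 Generic in the swap: `w₀ (g ⊕ 1) w₀ ∈ P_Δ` with `det_Δ = α` -/

section Generic

variable {y ys : Fin n → LocalRing E v}

/-- `y` is torsion-free when it has a partner: `c • y = 0 → c = 0` (pair with `y*`: `h(y*, c y) = c`).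
[cite: Dieudonne1971GroupesClassiques, Chap. II §5] -/
theorem eq_zero_of_smul_eq_zero_of_partner
    (hsy : hermForm (conjLocal E c v) (gramS F E v n T₀) ys y = 1) (a : LocalRing E v) (ha : a • y = 0) : a = 0 := by
  have h := hermForm_smul_right (conjLocal E c v) (gramS F E v n T₀) ys y a
  rw [ha, hermForm_zero_right, hsy, mul_one] at h
  exact h.symm

/-- **the adapted matrix of `p = w₀ (g ⊕ 1) w₀`** is `L · diag(g, 1) · L` for the swap matrix `L` of ★ p833917.
[cite: Kudla1994, §2] [cite: Dieudonne1971GroupesClassiques, Chap. II §5] -/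
theorem matA_swap_inlLoc_swap
    (h2 : hermForm (conjLocal E c v) (Matrix.fromBlocks (gramS F E v n T₀) 0 0 (-gramS F E v n T₀))
      (Sum.elim ys ys - Sum.elim y 0) (Sum.elim ys ys - Sum.elim y 0) = -2)
    (w₀ : UnitaryGroup.localPi E c (n + n) JD v)
    (hw₀ : matA F E c v n w₀ =
      (lineSwapGL (conjLocal E c v) (Matrix.fromBlocks (gramS F E v n T₀) 0 0 (-gramS F E v n T₀)) h2).val)
    (g : UnitaryGroup.localPi E c n J v) :
    matA F E c v n (w₀ * inlLoc F E c v n hJ hJD g * w₀) =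
      (lineSwapGL (conjLocal E c v) (Matrix.fromBlocks (gramS F E v n T₀) 0 0 (-gramS F E v n T₀)) h2).val *
        Matrix.fromBlocks (((UnitaryGroup.localPiEquiv E c n J v g).1 : GL (Fin n) (LocalRing E v)).1) 0 0 1 *
      (lineSwapGL (conjLocal E c v) (Matrix.fromBlocks (gramS F E v n T₀) 0 0 (-gramS F E v n T₀)) h2).val := by
  rw [← matA_mul, ← matA_mul, hw₀, matA_inlLoc]

/-- **`p (x, x) = (D x, D x)`** for `p = w₀ (g ⊕ 1) w₀`, `D x = x + (s(x) + h(y,x)(α − 1)) • y*`, when `g y = α y` and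
`g b(x) = b(x) + s(x) • y` on `b(x) = x − h(y,x) • y* ∈ y^⊥` (★ `swap_conj_blockOne_mulVec_diag` read on the group).
[cite: Kudla1994, §2, Thm. 3.1] [cite: Dieudonne1971GroupesClassiques, Chap. II §5] -/
theorem matA_swap_inlLoc_swap_mulVec_dblV
    (h2 : hermForm (conjLocal E c v) (Matrix.fromBlocks (gramS F E v n T₀) 0 0 (-gramS F E v n T₀))
      (Sum.elim ys ys - Sum.elim y 0) (Sum.elim ys ys - Sum.elim y 0) = -2)
    (hyy : hermForm (conjLocal E c v) (gramS F E v n T₀) y y = 0)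
    (hsy : hermForm (conjLocal E c v) (gramS F E v n T₀) ys y = 1)
    (hys : hermForm (conjLocal E c v) (gramS F E v n T₀) y ys = 1)
    (w₀ : UnitaryGroup.localPi E c (n + n) JD v)
    (hw₀ : matA F E c v n w₀ =
      (lineSwapGL (conjLocal E c v) (Matrix.fromBlocks (gramS F E v n T₀) 0 0 (-gramS F E v n T₀)) h2).val)
    (g : UnitaryGroup.localPi E c n J v) {α : LocalRing E v}
    (hgy : (((UnitaryGroup.localPiEquiv E c n J v g).1 : GL (Fin n) (LocalRing E v)).1) *ᵥ y = α • y)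
    (s : (Fin n → LocalRing E v) → LocalRing E v)
    (hs : ∀ x, (((UnitaryGroup.localPiEquiv E c n J v g).1 : GL (Fin n) (LocalRing E v)).1) *ᵥ
        (x - hermForm (conjLocal E c v) (gramS F E v n T₀) y x • ys) =
      (x - hermForm (conjLocal E c v) (gramS F E v n T₀) y x • ys) + s x • y)
    (x : Fin n → LocalRing E v) :
    matA F E c v n (w₀ * inlLoc F E c v n hJ hJD g * w₀) *ᵥ dblV x =
      dblV (x + (s x + hermForm (conjLocal E c v) (gramS F E v n T₀) y x * (α - 1)) • ys) := by
  rw [matA_swap_inlLoc_swap F E c v n hJ hJD h2 w₀ hw₀ g, ← Matrix.mulVec_mulVec, ← Matrix.mulVec_mulVec, dblV, dblV,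
    swap_conj_blockOne_mulVec_diag (conjLocal E c v) (gramS F E v n T₀) h2 hyy hsy hys hgy s hs x]

/-- **the adapted blocks of `p = w₀ (g ⊕ 1) w₀`**: `A_p x = D x` and `C_p x = 0` for every `x` (so `p ∈ P_Δ = {C = 0}` with
`Δ`-block `D`). [cite: Kudla1994, §3, Thm. 3.1] [cite: HarrisKudlaSweet1996, §1 (1.11)] -/
theorem blkA_blkC_swap_inlLoc_swap_mulVec
    (h2 : hermForm (conjLocal E c v) (Matrix.fromBlocks (gramS F E v n T₀) 0 0 (-gramS F E v n T₀))
      (Sum.elim ys ys - Sum.elim y 0) (Sum.elim ys ys - Sum.elim y 0) = -2)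
    (hyy : hermForm (conjLocal E c v) (gramS F E v n T₀) y y = 0)
    (hsy : hermForm (conjLocal E c v) (gramS F E v n T₀) ys y = 1)
    (hys : hermForm (conjLocal E c v) (gramS F E v n T₀) y ys = 1)
    (w₀ : UnitaryGroup.localPi E c (n + n) JD v)
    (hw₀ : matA F E c v n w₀ =
      (lineSwapGL (conjLocal E c v) (Matrix.fromBlocks (gramS F E v n T₀) 0 0 (-gramS F E v n T₀)) h2).val)
    (g : UnitaryGroup.localPi E c n J v) {α : LocalRing E v}
    (hgy : (((UnitaryGroup.localPiEquiv E c n J v g).1 : GL (Fin n) (LocalRing E v)).1) *ᵥ y = α • y)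
    (s : (Fin n → LocalRing E v) → LocalRing E v)
    (hs : ∀ x, (((UnitaryGroup.localPiEquiv E c n J v g).1 : GL (Fin n) (LocalRing E v)).1) *ᵥ
        (x - hermForm (conjLocal E c v) (gramS F E v n T₀) y x • ys) =
      (x - hermForm (conjLocal E c v) (gramS F E v n T₀) y x • ys) + s x • y)
    (x : Fin n → LocalRing E v) :
    blkA (matA F E c v n (w₀ * inlLoc F E c v n hJ hJD g * w₀)) *ᵥ x =
        x + (s x + hermForm (conjLocal E c v) (gramS F E v n T₀) y x * (α - 1)) • ys ∧
      blkC (matA F E c v n (w₀ * inlLoc F E c v n hJ hJD g * w₀)) *ᵥ x = 0 := by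
  have h := matA_swap_inlLoc_swap_mulVec_dblV F E c v n hJ hJD h2 hyy hsy hys w₀ hw₀ g hgy s hs x
  rw [mulVec_dblV] at h
  have h0 : dblV (x + (s x + hermForm (conjLocal E c v) (gramS F E v n T₀) y x * (α - 1)) • ys) =
      dblV (x + (s x + hermForm (conjLocal E c v) (gramS F E v n T₀) y x * (α - 1)) • ys) +
        adblV (0 : Fin n → LocalRing E v) := by
    have hz : adblV (0 : Fin n → LocalRing E v) = 0 := by
      funext k; rcases k with i | i <;> simp [adblV]
    rw [hz, add_zero]
  rw [h0] at h
  exact dblV_add_adblV_inj h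

/-- **`w₀ (g ⊕ 1) w₀ ∈ P_Δ`** for any `w₀ ∈ H(F_v)` whose adapted matrix is the hyperbolic swap along `(y*, y*) − (y, 0)` and
any `g ∈ U(T₀ ⊗ 1)(F_v)` with `g y = α y` and `g b ∈ b + S y` for all `b ⊥ y` (the elements of `P(ℓ)`, `ℓ = S y`, acting
trivially on `ℓ^⊥/ℓ`: `N(ℓ)`, the torus `m(α)`). [cite: Kudla1994, §2–§3, Thm. 3.1] [cite: HarrisKudlaSweet1996, §1 (1.11)] -/
theorem isSiegelDelta_of_matA_eq_lineSwap [Algebra.IsQuadraticExtension F E]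
    {δ : E} (hcδ : c δ = -δ) (hδ : δ ≠ 0) {d : F} (hd : δ * δ = algebraMap F E d) (hT₀ : T₀.IsSymm)
    (h2 : hermForm (conjLocal E c v) (Matrix.fromBlocks (gramS F E v n T₀) 0 0 (-gramS F E v n T₀))
      (Sum.elim ys ys - Sum.elim y 0) (Sum.elim ys ys - Sum.elim y 0) = -2)
    (hyy : hermForm (conjLocal E c v) (gramS F E v n T₀) y y = 0)
    (hsy : hermForm (conjLocal E c v) (gramS F E v n T₀) ys y = 1)
    (hys : hermForm (conjLocal E c v) (gramS F E v n T₀) y ys = 1)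
    (w₀ : UnitaryGroup.localPi E c (n + n) JD v)
    (hw₀ : matA F E c v n w₀ =
      (lineSwapGL (conjLocal E c v) (Matrix.fromBlocks (gramS F E v n T₀) 0 0 (-gramS F E v n T₀)) h2).val)
    (g : UnitaryGroup.localPi E c n J v) {α : LocalRing E v}
    (hgy : (((UnitaryGroup.localPiEquiv E c n J v g).1 : GL (Fin n) (LocalRing E v)).1) *ᵥ y = α • y)
    (hgb : ∀ b : Fin n → LocalRing E v, hermForm (conjLocal E c v) (gramS F E v n T₀) y b = 0 →
      ∃ t : LocalRing E v, (((UnitaryGroup.localPiEquiv E c n J v g).1 : GL (Fin n) (LocalRing E v)).1) *ᵥ b = b + t • y) :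
    IsSiegelDelta F E c hcδ hδ hd v n hT₀ hJD (w₀ * inlLoc F E c v n hJ hJD g * w₀) := by
  -- the defect function `s`: `g b(x) = b(x) + s(x) • y` on `b(x) = x − h(y,x) • y* ∈ y^⊥`
  choose s hs using fun x : Fin n → LocalRing E v =>
    hgb (x - hermForm (conjLocal E c v) (gramS F E v n T₀) y x • ys)
      (hermForm_snd_lineSwap_diag_eq_zero (conjLocal E c v) (gramS F E v n T₀) hys x)
  rw [isSiegelDelta_iff_blkC_eq_zero F E c hcδ hδ hd v n hT₀ hJD]
  refine Matrix.toLin'.injective ?_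
  rw [map_zero]
  refine LinearMap.ext fun x => ?_
  rw [Matrix.toLin'_apply, LinearMap.zero_apply]
  exact (blkA_blkC_swap_inlLoc_swap_mulVec F E c v n hJ hJD h2 hyy hsy hys w₀ hw₀ g hgy s hs x).2

/-- **`det_Δ (w₀ (g ⊕ 1) w₀) = α` at every `w ∣ v`** under the same hypotheses: the `Δ`-block is `D = 1 + y* ⊗ φ`,
`φ(x) = h(y, D x − x)`, `φ(y*) = α − 1`, `det D = 1 + φ(y*) = α` (★ `det_deltaBlock_eq`), read at the place `w`.
[cite: Kudla1994, §2–§3, Thm. 3.1] [cite: HarrisKudlaSweet1996, §1 (1.15)] -/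
theorem detDelta_of_matA_eq_lineSwap
    (h2 : hermForm (conjLocal E c v) (Matrix.fromBlocks (gramS F E v n T₀) 0 0 (-gramS F E v n T₀))
      (Sum.elim ys ys - Sum.elim y 0) (Sum.elim ys ys - Sum.elim y 0) = -2)
    (hyy : hermForm (conjLocal E c v) (gramS F E v n T₀) y y = 0)
    (hsy : hermForm (conjLocal E c v) (gramS F E v n T₀) ys y = 1)
    (hys : hermForm (conjLocal E c v) (gramS F E v n T₀) y ys = 1)
    (w₀ : UnitaryGroup.localPi E c (n + n) JD v)
    (hw₀ : matA F E c v n w₀ =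
      (lineSwapGL (conjLocal E c v) (Matrix.fromBlocks (gramS F E v n T₀) 0 0 (-gramS F E v n T₀)) h2).val)
    (g : UnitaryGroup.localPi E c n J v) {α : LocalRing E v}
    (hgy : (((UnitaryGroup.localPiEquiv E c n J v g).1 : GL (Fin n) (LocalRing E v)).1) *ᵥ y = α • y)
    (hgb : ∀ b : Fin n → LocalRing E v, hermForm (conjLocal E c v) (gramS F E v n T₀) y b = 0 →
      ∃ t : LocalRing E v, (((UnitaryGroup.localPiEquiv E c n J v g).1 : GL (Fin n) (LocalRing E v)).1) *ᵥ b = b + t • y)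
    (w : PlacesOver E v) :
    detDelta F E c v n w (w₀ * inlLoc F E c v n hJ hJD g * w₀) = α w := by
  choose s hs using fun x : Fin n → LocalRing E v =>
    hgb (x - hermForm (conjLocal E c v) (gramS F E v n T₀) y x • ys)
      (hermForm_snd_lineSwap_diag_eq_zero (conjLocal E c v) (gramS F E v n T₀) hys x)
  set p := w₀ * inlLoc F E c v n hJ hJD g * w₀ with hp
  have hAC := blkA_blkC_swap_inlLoc_swap_mulVec F E c v n hJ hJD h2 hyy hsy hys w₀ hw₀ g hgy s hs
  -- `C_p = 0`
  have hC : blkC (matA F E c v n p) = 0 := by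
    refine Matrix.toLin'.injective ?_
    rw [map_zero]
    refine LinearMap.ext fun x => ?_
    rw [Matrix.toLin'_apply, LinearMap.zero_apply]
    exact (hAC x).2
  -- the linear form `φ(x) = h(y, A_p x − x) = s(x) + h(y,x)(α − 1)`, as a row vector `r`
  set r : Fin n → LocalRing E v :=
    Matrix.vecMul (⇑(conjLocal E c v) ∘ y) (gramS F E v n T₀ * (blkA (matA F E c v n p) - 1)) with hr_def
  have hr : ∀ x, r ⬝ᵥ x = s x + hermForm (conjLocal E c v) (gramS F E v n T₀) y x * (α - 1) := by
    intro x
    rw [hr_def, ← Matrix.dotProduct_mulVec, ← Matrix.mulVec_mulVec, ← hermForm_apply, Matrix.sub_mulVec, Matrix.one_mulVec,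
      (hAC x).1, add_sub_cancel_left, hermForm_smul_right, hys, mul_one]
  have hφ : s ys + hermForm (conjLocal E c v) (gramS F E v n T₀) y ys * (α - 1) = α - 1 :=
    deltaBlock_coeff_at_partner (conjLocal E c v) (gramS F E v n T₀) hys s (hs ys)
      (eq_zero_of_smul_eq_zero_of_partner F E c v n hsy)
  have hD := det_deltaBlock_eq (conjLocal E c v) (gramS F E v n T₀) s hr hφ
  -- `A_p = 1 + y* ⊗ r`
  have hA : blkA (matA F E c v n p) = 1 + Matrix.vecMulVec ys r := by
    refine Matrix.toLin'.injective (LinearMap.ext fun x => ?_)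
    rw [Matrix.toLin'_apply, Matrix.toLin'_apply, (hAC x).1, (hD.1 x)]
  -- `det_Δ p` at `w` is the `w`-component of `det (M₁₁ + M₁₂) = det (A_p + C_p) = det A_p = α`
  have hblk : deltaBlock F E c v n w p = (blkA (matA F E c v n p) + blkC (matA F E c v n p)).map (Pi.evalRingHom _ w) := by
    rw [blkA_add_blkC, deltaBlock, coe_component_eq_matS_map, Matrix.map_add _ (map_add _)]
    rfl
  rw [detDelta, hblk, hC, add_zero, hA, ← RingHom.mapMatrix_apply, ← RingHom.map_det, hD.2, Pi.evalRingHom_apply]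

end Generic

/-! ## §3 The swap element `w₀ ∈ H(F_v)` -/

omit [NumberField F] [NumberField E] in
include hJD in
/-- **`J^𝔻` is hermitian**: `((J^𝔻)^c)ᵀ = J^𝔻` (`J^𝔻 = T^𝔻 ⊗ 1` with `T^𝔻 = T₀ ⊕ (−T₀)` symmetric, `c` an `F`-algebra map).
[cite: HarrisKudlaSweet1996, §1 (1.9)] -/
theorem conjTranspose_hermD (hT₀ : T₀.IsSymm) : (JD.map c)ᵀ = JD := by
  have hc : (⇑c ∘ ⇑(algebraMap F E)) = ⇑(algebraMap F E) := funext fun x => c.commutes x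
  rw [hJD, Matrix.map_map, hc, ← Matrix.transpose_map, (gramD_isSymm F n hT₀).eq]

variable {y ys : Fin n → LocalRing E v}

include hJD in
/-- **`h_𝔻(e − f, e − f) = −2` in the tree's `Fin (n + n)` coordinates** for the hyperbolic pair `e = (y*, y*)`, `f = (y, 0)`
of `𝔻` built on a hyperbolic frame `(y, y*)` of `𝕍` (★ `hermForm_doubled_swapVector` re-enumerated along `e₂`; the
hypothesis of ★ `localSwapElt`). [cite: Dieudonne1971GroupesClassiques, Chap. II §5] -/
theorem hermForm_localFormD_swapVector
    (hyy : hermForm (conjLocal E c v) (gramS F E v n T₀) y y = 0)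
    (hsy : hermForm (conjLocal E c v) (gramS F E v n T₀) ys y = 1)
    (hys : hermForm (conjLocal E c v) (gramS F E v n T₀) y ys = 1) :
    hermForm (conjLocal E c v) ((adelicForm E (n + n) JD).map (adeleToLocal E v))
      (Sum.elim ys ys ∘ ⇑(e₂ n).symm - Sum.elim y 0 ∘ ⇑(e₂ n).symm)
      (Sum.elim ys ys ∘ ⇑(e₂ n).symm - Sum.elim y 0 ∘ ⇑(e₂ n).symm) = -2 := by
  have hU : Sum.elim ys ys ∘ ⇑(e₂ n).symm - Sum.elim y 0 ∘ ⇑(e₂ n).symm = (Sum.elim ys ys - Sum.elim y 0) ∘ ⇑(e₂ n).symm :=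
    rfl
  rw [localFormD_eq F E v n hJD, hU, hermForm_reindex]
  exact hermForm_doubled_swapVector (conjLocal E c v) (gramS F E v n T₀) hyy hsy hys

/-- **`w₀ w₀ = 1`** for the swap element `w₀ := localSwapElt …` (an involution, ★ `localSwapElt_inv`).
[cite: Dieudonne1971GroupesClassiques, Chap. II §5] -/
theorem localSwapElt_mul_self [Algebra.IsQuadraticExtension F E] {δ : E} (hcδ : c δ = -δ) (hδ : δ ≠ 0) {N : ℕ} {J' : Matrix (Fin N) (Fin N) E}
    (hJh : (J'.map c)ᵀ = J') {r r' : Fin N → LocalRing E v}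
    (h2 : hermForm (conjLocal E c v) ((adelicForm E N J').map (adeleToLocal E v)) (r - r') (r - r') = -2) :
    localSwapElt E c N J' v hcδ hδ hJh h2 * localSwapElt E c N J' v hcδ hδ hJh h2 = 1 := by
  nth_rewrite 1 [← localSwapElt_inv E c N J' v hcδ hδ hJh h2]
  exact inv_mul_cancel _

include hJD in
/-- **the adapted matrix of the swap element is the swap of ★ p833917**: `matA w₀ = lineSwapGL σ (G ⊕ −G) h2` in the
`Fin n ⊕ Fin n` blocks (re-enumeration of ★ `lineSwapGL_mulVec` along `e₂`, ★ `localFormD_eq`, ★ `hermForm_reindex`).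
[cite: Dieudonne1971GroupesClassiques, Chap. II §5] [cite: Kudla1994, §2] -/
theorem matA_localSwapElt [Algebra.IsQuadraticExtension F E] {δ : E} (hcδ : c δ = -δ) (hδ : δ ≠ 0) (hJh : (JD.map c)ᵀ = JD)
    (h2D : hermForm (conjLocal E c v) ((adelicForm E (n + n) JD).map (adeleToLocal E v))
      (Sum.elim ys ys ∘ ⇑(e₂ n).symm - Sum.elim y 0 ∘ ⇑(e₂ n).symm)
      (Sum.elim ys ys ∘ ⇑(e₂ n).symm - Sum.elim y 0 ∘ ⇑(e₂ n).symm) = -2)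
    (h2 : hermForm (conjLocal E c v) (Matrix.fromBlocks (gramS F E v n T₀) 0 0 (-gramS F E v n T₀))
      (Sum.elim ys ys - Sum.elim y 0) (Sum.elim ys ys - Sum.elim y 0) = -2) :
    matA F E c v n (localSwapElt E c (n + n) JD v hcδ hδ hJh h2D) =
      (lineSwapGL (conjLocal E c v) (Matrix.fromBlocks (gramS F E v n T₀) 0 0 (-gramS F E v n T₀)) h2).val := by
  have hU : Sum.elim ys ys ∘ ⇑(e₂ n).symm - Sum.elim y 0 ∘ ⇑(e₂ n).symm = (Sum.elim ys ys - Sum.elim y 0) ∘ ⇑(e₂ n).symm :=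
    rfl
  refine Matrix.toLin'.injective (LinearMap.ext fun u => ?_)
  rw [Matrix.toLin'_apply, Matrix.toLin'_apply, matA_mulVec, matS, coe_localPiEquiv_localSwapElt, lineSwapGL_mulVec,
    lineSwapGL_mulVec, localFormD_eq F E v n hJD, hU, hermForm_reindex]
  funext k
  simp only [Function.comp_apply, Pi.add_apply, Pi.smul_apply, Pi.sub_apply, smul_eq_mul, Equiv.symm_apply_apply]

/-! ## §4 The sockets of the CM-datum assembler -/

/-- **(s) `w₀ (g ⊕ 1) w₀ ∈ P_Δ`** for THE swap element `w₀ = localSwapElt …` of the frame `(y, y*)` and every `g ∈ U(T₀ ⊗ 1)(F_v)`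
with `g y = α y`, `g b ∈ b + S y` (`b ⊥ y`). [cite: Kudla1994, §2–§3, Thm. 3.1] [cite: HarrisKudlaSweet1996, §1 (1.11)] -/
theorem isSiegelDelta_swap_inlLoc_swap [Algebra.IsQuadraticExtension F E]
    {δ : E} (hcδ : c δ = -δ) (hδ : δ ≠ 0) {d : F} (hd : δ * δ = algebraMap F E d) (hT₀ : T₀.IsSymm)
    (hyy : hermForm (conjLocal E c v) (gramS F E v n T₀) y y = 0)
    (hsy : hermForm (conjLocal E c v) (gramS F E v n T₀) ys y = 1)
    (hys : hermForm (conjLocal E c v) (gramS F E v n T₀) y ys = 1)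
    (g : UnitaryGroup.localPi E c n J v) {α : LocalRing E v}
    (hgy : (((UnitaryGroup.localPiEquiv E c n J v g).1 : GL (Fin n) (LocalRing E v)).1) *ᵥ y = α • y)
    (hgb : ∀ b : Fin n → LocalRing E v, hermForm (conjLocal E c v) (gramS F E v n T₀) y b = 0 →
      ∃ t : LocalRing E v, (((UnitaryGroup.localPiEquiv E c n J v g).1 : GL (Fin n) (LocalRing E v)).1) *ᵥ b = b + t • y) :
    IsSiegelDelta F E c hcδ hδ hd v n hT₀ hJD
      (localSwapElt E c (n + n) JD v hcδ hδ (conjTranspose_hermD F E c n hJD hT₀)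
          (hermForm_localFormD_swapVector F E c v n hJD hyy hsy hys) *
        inlLoc F E c v n hJ hJD g *
        localSwapElt E c (n + n) JD v hcδ hδ (conjTranspose_hermD F E c n hJD hT₀)
          (hermForm_localFormD_swapVector F E c v n hJD hyy hsy hys)) :=
  isSiegelDelta_of_matA_eq_lineSwap F E c v n hJ hJD hcδ hδ hd hT₀ (hermForm_doubled_swapVector _ _ hyy hsy hys) hyy hsy hys _
    (matA_localSwapElt F E c v n hJD hcδ hδ _ _ _) g hgy hgb

/-- **(s) `det_Δ (w₀ (g ⊕ 1) w₀) = α` at every `w ∣ v`** for THE swap element (the torus case `m(α)`: `α = ` the eigenvalue of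
`g` on the line `ℓ = S y`; the `N(ℓ)` case: `α = 1`). [cite: Kudla1994, §2–§3, Thm. 3.1] [cite: HarrisKudlaSweet1996, §1 (1.15)] -/
theorem detDelta_swap_inlLoc_swap [Algebra.IsQuadraticExtension F E] {δ : E} (hcδ : c δ = -δ) (hδ : δ ≠ 0) (hT₀ : T₀.IsSymm)
    (hyy : hermForm (conjLocal E c v) (gramS F E v n T₀) y y = 0)
    (hsy : hermForm (conjLocal E c v) (gramS F E v n T₀) ys y = 1)
    (hys : hermForm (conjLocal E c v) (gramS F E v n T₀) y ys = 1)
    (g : UnitaryGroup.localPi E c n J v) {α : LocalRing E v}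
    (hgy : (((UnitaryGroup.localPiEquiv E c n J v g).1 : GL (Fin n) (LocalRing E v)).1) *ᵥ y = α • y)
    (hgb : ∀ b : Fin n → LocalRing E v, hermForm (conjLocal E c v) (gramS F E v n T₀) y b = 0 →
      ∃ t : LocalRing E v, (((UnitaryGroup.localPiEquiv E c n J v g).1 : GL (Fin n) (LocalRing E v)).1) *ᵥ b = b + t • y)
    (w : PlacesOver E v) :
    detDelta F E c v n w
      (localSwapElt E c (n + n) JD v hcδ hδ (conjTranspose_hermD F E c n hJD hT₀)
          (hermForm_localFormD_swapVector F E c v n hJD hyy hsy hys) *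
        inlLoc F E c v n hJ hJD g *
        localSwapElt E c (n + n) JD v hcδ hδ (conjTranspose_hermD F E c n hJD hT₀)
          (hermForm_localFormD_swapVector F E c v n hJD hyy hsy hys)) = α w :=
  detDelta_of_matA_eq_lineSwap F E c v n hJ hJD (hermForm_doubled_swapVector _ _ hyy hsy hys) hyy hsy hys _
    (matA_localSwapElt F E c v n hJD hcδ hδ _ _ _) g hgy hgb w

/-- **(s1) the `N(ℓ)` case**: `g y = y`, `g b ∈ b + S y` (`b ⊥ y`) ⟹ `w₀ (g ⊕ 1) w₀ ∈ P_Δ` with `det_Δ = 1` at every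
`w ∣ v` (the shape of the assembler's `hN`). [cite: Kudla1994, §2–§3, Thm. 3.1] [cite: HarrisKudlaSweet1996, §1 (1.11), (1.15)] -/
theorem isSiegelDelta_and_detDelta_eq_one_swap_inlLoc_swap [Algebra.IsQuadraticExtension F E]
    {δ : E} (hcδ : c δ = -δ) (hδ : δ ≠ 0) {d : F} (hd : δ * δ = algebraMap F E d) (hT₀ : T₀.IsSymm)
    (hyy : hermForm (conjLocal E c v) (gramS F E v n T₀) y y = 0)
    (hsy : hermForm (conjLocal E c v) (gramS F E v n T₀) ys y = 1)
    (hys : hermForm (conjLocal E c v) (gramS F E v n T₀) y ys = 1)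
    (g : UnitaryGroup.localPi E c n J v)
    (hgy : (((UnitaryGroup.localPiEquiv E c n J v g).1 : GL (Fin n) (LocalRing E v)).1) *ᵥ y = y)
    (hgb : ∀ b : Fin n → LocalRing E v, hermForm (conjLocal E c v) (gramS F E v n T₀) y b = 0 →
      ∃ t : LocalRing E v, (((UnitaryGroup.localPiEquiv E c n J v g).1 : GL (Fin n) (LocalRing E v)).1) *ᵥ b = b + t • y) :
    IsSiegelDelta F E c hcδ hδ hd v n hT₀ hJD
        (localSwapElt E c (n + n) JD v hcδ hδ (conjTranspose_hermD F E c n hJD hT₀)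
            (hermForm_localFormD_swapVector F E c v n hJD hyy hsy hys) *
          inlLoc F E c v n hJ hJD g *
          localSwapElt E c (n + n) JD v hcδ hδ (conjTranspose_hermD F E c n hJD hT₀)
            (hermForm_localFormD_swapVector F E c v n hJD hyy hsy hys)) ∧
      ∀ w : PlacesOver E v, detDelta F E c v n w
        (localSwapElt E c (n + n) JD v hcδ hδ (conjTranspose_hermD F E c n hJD hT₀)
            (hermForm_localFormD_swapVector F E c v n hJD hyy hsy hys) *
          inlLoc F E c v n hJ hJD g *
          localSwapElt E c (n + n) JD v hcδ hδ (conjTranspose_hermD F E c n hJD hT₀)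
            (hermForm_localFormD_swapVector F E c v n hJD hyy hsy hys)) = 1 := by
  have hgy' : (((UnitaryGroup.localPiEquiv E c n J v g).1 : GL (Fin n) (LocalRing E v)).1) *ᵥ y = (1 : LocalRing E v) • y := by
    rw [one_smul]; exact hgy
  exact ⟨isSiegelDelta_swap_inlLoc_swap F E c v n hJ hJD hcδ hδ hd hT₀ hyy hsy hys g hgy' hgb, fun w => by
    rw [detDelta_swap_inlLoc_swap F E c v n hJ hJD hcδ hδ hT₀ hyy hsy hys g hgy' hgb w, Pi.one_apply]⟩

/-- **(w)+(s) THE ∃-PACKAGE**: a hyperbolic frame `(y, y*)` of `𝕍 ⊗ F_v` gives an involution `w₀ ∈ H(F_v)` such that for every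
`g ∈ U(T₀ ⊗ 1)(F_v)` acting on `ℓ = S y` by `α` and trivially on `ℓ^⊥/ℓ`, `w₀ (g ⊕ 1) w₀ ∈ P_Δ` with `det_Δ = α` at
every `w ∣ v`. [cite: Kudla1994, §2–§3, Thm. 3.1] [cite: HarrisKudlaSweet1996, §1 (1.11), (1.15)]
[cite: Dieudonne1971GroupesClassiques, Chap. II §5] -/
theorem exists_involution_forall_isSiegelDelta [Algebra.IsQuadraticExtension F E]
    {δ : E} (hcδ : c δ = -δ) (hδ : δ ≠ 0) {d : F} (hd : δ * δ = algebraMap F E d) (hT₀ : T₀.IsSymm)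
    (hyy : hermForm (conjLocal E c v) (gramS F E v n T₀) y y = 0)
    (hsy : hermForm (conjLocal E c v) (gramS F E v n T₀) ys y = 1)
    (hys : hermForm (conjLocal E c v) (gramS F E v n T₀) y ys = 1) :
    ∃ w₀ : UnitaryGroup.localPi E c (n + n) JD v, w₀ * w₀ = 1 ∧
      ∀ (g : UnitaryGroup.localPi E c n J v) (α : LocalRing E v),
        (((UnitaryGroup.localPiEquiv E c n J v g).1 : GL (Fin n) (LocalRing E v)).1) *ᵥ y = α • y →
        (∀ b : Fin n → LocalRing E v, hermForm (conjLocal E c v) (gramS F E v n T₀) y b = 0 →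
          ∃ t : LocalRing E v, (((UnitaryGroup.localPiEquiv E c n J v g).1 : GL (Fin n) (LocalRing E v)).1) *ᵥ b = b + t • y) →
        IsSiegelDelta F E c hcδ hδ hd v n hT₀ hJD (w₀ * inlLoc F E c v n hJ hJD g * w₀) ∧
          ∀ w : PlacesOver E v, detDelta F E c v n w (w₀ * inlLoc F E c v n hJ hJD g * w₀) = α w :=
  ⟨_, localSwapElt_mul_self F E c v hcδ hδ (conjTranspose_hermD F E c n hJD hT₀)
      (hermForm_localFormD_swapVector F E c v n hJD hyy hsy hys),
    fun g _ hgy hgb => ⟨isSiegelDelta_swap_inlLoc_swap F E c v n hJ hJD hcδ hδ hd hT₀ hyy hsy hys g hgy hgb,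
      fun w => detDelta_swap_inlLoc_swap F E c v n hJ hJD hcδ hδ hT₀ hyy hsy hys g hgy hgb w⟩⟩

end Summit.HodgeConjecture.HodgeConjecture.Cruxes.H413.F0P2oDoubledSwapSiegel

end
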